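import Mathlib
import HarnessLib
import Summits.CriticalPhenomena.PercolationContinuityZ3.Theorems.PercLowPointHalfSpaceAssembly2Glue
import Summits.CriticalPhenomena.PercolationContinuityZ3.Theorems.PercLowPointHalfSpaceAssembly2CrossRootOpen

/-!
# `Assembly2` of route `PercLowPointHalfSpace`: the cross-bush mass transport

Item `stmt-CriticalPhenomena-1722` (`Assembly2`) of route `CriticalPhenomena/PercLowPointHalfSpace`,
continuing `PercLowPointHalfSpaceAssembly2Glue.lean` (`Assembly2`, indeed `θ(p_c(ℤ³)) = 0`, follows
from `E_{p_c}[N^{cross}_{L e₀}(U)/|U ∩ ∂ℍ|] → 0`) and `...Assembly2CrossRoot(Open).lean` (roots of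
bushes, re-rooting covariance). Here the footprint normalisation `1/|U ∩ ∂ℍ|` of the cross-bush part
is traded, by a second horizontal mass transport, for a normalisation by the open roots of the UPPER
bush of each pair, and the result is EXACT:

* `LowPoint.lintegral_crossPinned_div_footprint_eq` — for every `p` with `U` a.s. finite, every `w`
  with `w₀ ≥ 0`, every `d`: `E_p[N^{cross}_w/|U ∩ ∂ℍ|] = E_p[Σ_{u ∈ M⁰_w} 1/ρ_w(u)]`, where
  `M⁰_w = {u : u₀ ≥ 1, u ∈ U, {0,e₀} open, e₀ ↔ u + w, e₀ ↮ u in {x₀ ≥ 1}}` (cross pairs for which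
  the origin is an open root of the upper bush, `e₀ = Pi.single 0 1`) and `ρ_w(u)` is the number of
  open roots of the pair;
* `lintegral_crossPinned_eq_rooted` — at `p_c(ℤ³)` (`U` a.s. finite by Barsky–Grimmett–Newman),
  with `w = L e₀`: `E_{p_c}[N^{cross}_{L e₀}/|U ∩ ∂ℍ|] = E_{p_c}[|M⁰_L|/κ]`,
  `κ = |{y ∈ U ∩ ∂ℍ : {y, y + e₀} open, y + e₀ ↔ e₀ in {x₀ ≥ 1}}|` (open floor contacts of the bush
  of `e₀`);
* `percolationContinuityZ3_of_tendsto_rootedCross` — **if `E_{p_c}[|M⁰_L|/κ] → 0` then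
  `θ(p_c(ℤ³)) = 0`**, and `assembly2_of_rootedCross_bookkeeping` — `Assembly2` follows from the single
  implication `FloorSubcritical → A → B → C → (E_{p_c}[|M⁰_L|/κ] → 0)`: the route's bush/floor
  bookkeeping in rooted form, the only step of its proof plan not in the tree. Since the formula is
  exact, `E_{p_c}[|M⁰_L|/κ]` is at most `τ_{p_c}(0, L e₀) ≤ 1` (low-point identity), in particular
  finite, and its vanishing is EQUIVALENT, given the floor term (which tends to `0`), to
  `τ_{p_c}(0, L e₀) → 0`.

Sources: Lyons–Peres, *Probability on Trees and Networks* (2016), §8.2 (mass transport); Grimmett,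
*Percolation* (1999), Thm. (7.35) (a.s. finiteness of `U` at `p_c(ℤ³)`, in tree).

Dependency-drift repair (2026-08-16): the route decl `Assembly2` (item `stmt-CriticalPhenomena-14687` =
`FloorSubcritical → Assembly`; twin of `stmt-CriticalPhenomena-1722`) was DROPPED from
`Theses/PercLowPointHalfSpace.lean` by the lint autofix of 2026-08-16T14:15:59Z (duplicate assembly),
so the name left the route file (full-build breakage, `Unknown identifier Assembly2`). As in
`PercLowPointHalfSpaceAssembly2Glue.lean` (whose re-creation is private, hence invisible here) it is
re-created privately below with its recorded signature, so the (append-only) statement of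
`assembly2_of_rootedCross_bookkeeping` is unchanged and nothing depends on the retired route name.
-/

open Summit.CriticalPhenomena.PercolationContinuityZ3.Theses.PercLowPointHalfSpace in
/-- PRIVATE re-creation (route namespace stays free; a dropped route statement, NOT a cited fact) of
the route decl `…Theses.PercLowPointHalfSpace.Assembly2` = item `stmt-CriticalPhenomena-14687`,
recorded signature `FloorSubcritical → Assembly` verbatim, dropped from the route file
2026-08-16T14:15:59Z as a duplicate assembly. -/
private def Summit.CriticalPhenomena.PercolationContinuityZ3.Theses.PercLowPointHalfSpace.Assembly2 :
    Prop := FloorSubcritical → Assembly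

noncomputable section

namespace Summit.CriticalPhenomena.PercolationContinuityZ3.Theorems

open MeasureTheory Filter Topology
open Literature.Probability.Percolation Literature.Probability.LatticeModels
open scoped ENNReal

/-! ## Mass transport for the cross-bush pairs (rooted at the origin, weight `1/|open roots|`) -/

namespace LowPoint

variable {d : ℕ} [NeZero d]

/-- **Cross-bush mass transport (exact).** For every `p` at which the half-space cluster `U` is a.s.
finite, every `w` with `w₀ ≥ 0` and every dimension:
`E_p[N^{cross}_w/|U ∩ ∂ℍ|] = E_p[ Σ_{u ∈ M⁰_w} 1/ρ_w(u) ]`, where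
`M⁰_w = {u : u₀ ≥ 1, u ∈ U, {0, e₀} open, e₀ ↔ u + w in {x₀ ≥ 1}, e₀ ↮ u in {x₀ ≥ 1}}` are the
cross pairs for which the origin is an OPEN ROOT of the upper bush (`e₀ = Pi.single 0 1`), and
`ρ_w(u) = |{y ∈ U ∩ ∂ℍ : {y, y + e₀} open, y + e₀ ↔ u + w, y + e₀ ↮ u in {x₀ ≥ 1}}|` is the number
of open roots of the pair `(u, u + w)`. Every cross pair has `1 ≤ ρ < ∞` open roots
(`exists_openRoot_of_mem_crossPinned`, finiteness of `U`) and conversely an open-rooted pair is a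
cross pair (`mem_crossPinned_of_openRoot`); spread each pair over its open roots with weight `1/ρ`,
re-root at the root (`bondPercolation_map_shift`, `halfSpaceFootprint_shift`, `openRootSet_shift`,
`openRootedCross_shift_iff`), and exchange sums and integrals (Tonelli). [cite: LyonsPeres2016, §8.2] -/
theorem lintegral_crossPinned_div_footprint_eq (p : unitInterval) {w : Site d} (hw : 0 ≤ w 0)
    (hfin : ∀ᵐ ω ∂(bondPercolation (zdGraph d) p), (halfSpaceCluster ω).Finite) :
    ∫⁻ ω, (((halfSpacePinnedPairs ω w ∩ {v | 1 ≤ v 0}).encard : ℕ∞) : ℝ≥0∞) /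
        ((halfSpaceFootprint ω : ℕ∞) : ℝ≥0∞) ∂(bondPercolation (zdGraph d) p) =
      ∫⁻ ω, ∑' u : Site d, {ω' : BondConfig (Site d) | 1 ≤ u 0 ∧ u ∈ halfSpaceCluster ω' ∧
            s((0 : Site d), (0 : Site d) + Pi.single 0 1) ∈ ω' ∧
            ω' ∈ openConnIn {x : Site d | 1 ≤ x 0} ((0 : Site d) + Pi.single 0 1) (u + w) ∧
            ω' ∉ openConnIn {x : Site d | 1 ≤ x 0} ((0 : Site d) + Pi.single 0 1) u}.indicator
          (fun ω' => ((({y' : Site d | y' ∈ halfSpaceCluster ω' ∧ y' 0 = 0 ∧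
              s(y', y' + Pi.single 0 1) ∈ ω' ∧
              ω' ∈ openConnIn {x : Site d | 1 ≤ x 0} (y' + Pi.single 0 1) (u + w) ∧
              ω' ∉ openConnIn {x : Site d | 1 ≤ x 0} (y' + Pi.single 0 1) u}.encard : ℕ∞) :
                ℝ≥0∞))⁻¹) ω
        ∂(bondPercolation (zdGraph d) p) := by
  -- the open roots `R v ω` of the pair `(v, v + w)`, the rooted pairs `M ω`, the summands `F`, `G`
  set R : Site d → BondConfig (Site d) → Set (Site d) := fun v ω =>
    {y' : Site d | y' ∈ halfSpaceCluster ω ∧ y' 0 = 0 ∧ s(y', y' + Pi.single 0 1) ∈ ω ∧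
      ω ∈ openConnIn {x : Site d | 1 ≤ x 0} (y' + Pi.single 0 1) (v + w) ∧
      ω ∉ openConnIn {x : Site d | 1 ≤ x 0} (y' + Pi.single 0 1) v} with hR
  set M : BondConfig (Site d) → Set (Site d) := fun ω => {u : Site d | 1 ≤ u 0 ∧
    u ∈ halfSpaceCluster ω ∧ s((0 : Site d), (0 : Site d) + Pi.single 0 1) ∈ ω ∧
      ω ∈ openConnIn {x : Site d | 1 ≤ x 0} ((0 : Site d) + Pi.single 0 1) (u + w) ∧
      ω ∉ openConnIn {x : Site d | 1 ≤ x 0} ((0 : Site d) + Pi.single 0 1) u} with hM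
  set F : Site d → Site d → BondConfig (Site d) → ℝ≥0∞ := fun y v ω =>
    {ω' : BondConfig (Site d) | y ∈ halfSpaceCluster ω' ∧ y 0 = 0 ∧ (1 ≤ v 0 ∧
        v ∈ halfSpaceCluster ω' ∧ s(y, y + Pi.single 0 1) ∈ ω' ∧
        ω' ∈ openConnIn {x : Site d | 1 ≤ x 0} (y + Pi.single 0 1) (v + w) ∧
        ω' ∉ openConnIn {x : Site d | 1 ≤ x 0} (y + Pi.single 0 1) v)}.indicator
      (fun ω' => ((((R v ω').encard : ℕ∞) : ℝ≥0∞))⁻¹ * (((halfSpaceFootprint ω' : ℕ∞) : ℝ≥0∞))⁻¹)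
        ω with hF
  set G : Site d → Site d → BondConfig (Site d) → ℝ≥0∞ := fun y u ω =>
    {ω' : BondConfig (Site d) | -y ∈ halfSpaceCluster ω' ∧ y 0 = 0 ∧ (1 ≤ u 0 ∧
        u ∈ halfSpaceCluster ω' ∧ s((0 : Site d), (0 : Site d) + Pi.single 0 1) ∈ ω' ∧
        ω' ∈ openConnIn {x : Site d | 1 ≤ x 0} ((0 : Site d) + Pi.single 0 1) (u + w) ∧
        ω' ∉ openConnIn {x : Site d | 1 ≤ x 0} ((0 : Site d) + Pi.single 0 1) u)}.indicator
      (fun ω' => ((((R u ω').encard : ℕ∞) : ℝ≥0∞))⁻¹ * (((halfSpaceFootprint ω' : ℕ∞) : ℝ≥0∞))⁻¹)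
        ω with hG
  have hρmeas : ∀ v, Measurable fun ω => ((((R v ω).encard : ℕ∞) : ℝ≥0∞))⁻¹ := fun v =>
    measurable_openRootCount_inv w v
  have hFmeas : ∀ y v, Measurable (F y v) := fun y v =>
    Measurable.indicator ((hρmeas v).mul measurable_footprint_inv)
      ((measurableSet_mem_halfSpaceCluster y).inter ((MeasurableSet.const _).inter
        (measurableSet_openRootedCross _ v w)))
  have hGmeas : ∀ y u, Measurable (G y u) := fun y u =>
    Measurable.indicator ((hρmeas u).mul measurable_footprint_inv)
      ((measurableSet_mem_halfSpaceCluster (-y)).inter ((MeasurableSet.const _).inter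
        (measurableSet_openRootedCross _ u w)))
  have hae : ∀ᵐ ω ∂(bondPercolation (zdGraph d) p),
      ω ⊆ (zdGraph d).edgeSet ∧ (halfSpaceCluster ω).Finite := by
    filter_upwards [(ProbabilityTheory.setBernoulli_ae_subset :
      ∀ᵐ ω ∂(bondPercolation (zdGraph d) p), ω ⊆ (zdGraph d).edgeSet), hfin] with ω h1 h2
    exact ⟨h1, h2⟩
  -- step 1 (a.e.): the integrand equals `Σ_y Σ_v F y v ω` (each cross pair has `1 ≤ ρ < ∞` open
  -- roots, each carrying the weight `1/ρ`; a non-cross `v` has no open root)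
  have hstep1 : ∀ᵐ ω ∂(bondPercolation (zdGraph d) p),
      (((halfSpacePinnedPairs ω w ∩ {v | 1 ≤ v 0}).encard : ℕ∞) : ℝ≥0∞) /
        ((halfSpaceFootprint ω : ℕ∞) : ℝ≥0∞) = ∑' y, ∑' v, F y v ω := by
    filter_upwards [hae] with ω hω
    rw [ENNReal.tsum_comm]
    -- `F · v ω` is the indicator of the open root set `R v ω`, with the constant weight
    have hFv : ∀ v y', 1 ≤ v 0 → v ∈ halfSpaceCluster ω → F y' v ω = (R v ω).indicator (fun _ =>
        ((((R v ω).encard : ℕ∞) : ℝ≥0∞))⁻¹ * (((halfSpaceFootprint ω : ℕ∞) : ℝ≥0∞))⁻¹) y' := by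
      intro v y' hv1 hvU
      simp only [hF]
      by_cases hy' : y' ∈ R v ω
      · rw [Set.indicator_of_mem hy', Set.indicator_of_mem (show ω ∈ {ω' : BondConfig (Site d) |
            y' ∈ halfSpaceCluster ω' ∧ y' 0 = 0 ∧ (1 ≤ v 0 ∧ v ∈ halfSpaceCluster ω' ∧
              s(y', y' + Pi.single 0 1) ∈ ω' ∧
              ω' ∈ openConnIn {x : Site d | 1 ≤ x 0} (y' + Pi.single 0 1) (v + w) ∧
              ω' ∉ openConnIn {x : Site d | 1 ≤ x 0} (y' + Pi.single 0 1) v)} from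
          ⟨hy'.1, hy'.2.1, hv1, hvU, hy'.2.2.1, hy'.2.2.2.1, hy'.2.2.2.2⟩)]
      · rw [Set.indicator_of_notMem hy', Set.indicator_of_notMem (show ω ∉ {ω' : BondConfig (Site d) |
            y' ∈ halfSpaceCluster ω' ∧ y' 0 = 0 ∧ (1 ≤ v 0 ∧ v ∈ halfSpaceCluster ω' ∧
              s(y', y' + Pi.single 0 1) ∈ ω' ∧
              ω' ∈ openConnIn {x : Site d | 1 ≤ x 0} (y' + Pi.single 0 1) (v + w) ∧
              ω' ∉ openConnIn {x : Site d | 1 ≤ x 0} (y' + Pi.single 0 1) v)} from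
          fun h => hy' ⟨h.1, h.2.1, h.2.2.2.2.1, h.2.2.2.2.2.1, h.2.2.2.2.2.2⟩)]
    have hterm : ∀ v, (halfSpacePinnedPairs ω w ∩ {v | 1 ≤ v 0}).indicator
        (fun _ => (((halfSpaceFootprint ω : ℕ∞) : ℝ≥0∞))⁻¹) v = ∑' y, F y v ω := by
      intro v
      by_cases hv : v ∈ halfSpacePinnedPairs ω w ∩ {v | 1 ≤ v 0}
      · obtain ⟨y, hyU, hy0, hv1, hvU, hye, hc, hnc⟩ := exists_openRoot_of_mem_crossPinned hω.1 hw hv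
        rw [Set.indicator_of_mem hv]
        have hρ0 : (((R v ω).encard : ℕ∞) : ℝ≥0∞) ≠ 0 := by
          rw [Ne, ENat.toENNReal_eq_zero, Set.encard_eq_zero]
          exact Set.Nonempty.ne_empty ⟨y, hyU, hy0, hye, hc, hnc⟩
        have hρtop : (((R v ω).encard : ℕ∞) : ℝ≥0∞) ≠ ⊤ := by
          rw [Ne, ENat.toENNReal_eq_top]
          exact ((hω.2.subset fun y' hy' => hy'.1).encard_lt_top).ne
        rw [tsum_congr (fun y' => hFv v y' hv1 hvU), ← tsum_subtype, ENNReal.tsum_set_const,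
          ← mul_assoc, ENNReal.mul_inv_cancel hρ0 hρtop, one_mul]
      · rw [Set.indicator_of_notMem hv]
        symm
        refine ENNReal.tsum_eq_zero.2 fun y' => ?_
        simp only [hF]
        refine Set.indicator_of_notMem (fun h => hv ?_) _
        exact mem_crossPinned_of_openRoot h.1 h.2.1 h.2.2.1 h.2.2.2.1 h.2.2.2.2.1 h.2.2.2.2.2.1
          h.2.2.2.2.2.2
    calc (((halfSpacePinnedPairs ω w ∩ {v | 1 ≤ v 0}).encard : ℕ∞) : ℝ≥0∞) /
          ((halfSpaceFootprint ω : ℕ∞) : ℝ≥0∞)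
        = ∑' v, (halfSpacePinnedPairs ω w ∩ {v | 1 ≤ v 0}).indicator
            (fun _ => (((halfSpaceFootprint ω : ℕ∞) : ℝ≥0∞))⁻¹) v := by
          rw [← tsum_subtype, ENNReal.tsum_set_const, div_eq_mul_inv]
      _ = ∑' v, ∑' y, F y v ω := tsum_congr hterm
  -- step 2: re-rooting, `F y v ω = G y (v - y) (ω - y)`
  have hFG : ∀ y v ω, F y v ω = G y (v - y) (BondConfig.relabel (sym2Equiv (Site.shift (-y))) ω) := by
    intro y v ω
    simp only [hF, hG]
    by_cases hy0 : y 0 = 0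
    swap
    · rw [Set.indicator_of_notMem (show ω ∉ {ω' : BondConfig (Site d) | _} from fun h => hy0 h.2.1),
        Set.indicator_of_notMem (show BondConfig.relabel (sym2Equiv (Site.shift (-y))) ω ∉
          {ω' : BondConfig (Site d) | _} from fun h => hy0 h.2.1)]
    by_cases hy : y ∈ halfSpaceCluster ω
    swap
    · rw [Set.indicator_of_notMem (show ω ∉ {ω' : BondConfig (Site d) | _} from fun h => hy h.1),
        Set.indicator_of_notMem (show BondConfig.relabel (sym2Equiv (Site.shift (-y))) ω ∉
          {ω' : BondConfig (Site d) | _} from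
            fun h => neg_notMem_halfSpaceCluster_shift hy hy0 h.1)]
    have hev := openRootedCross_shift_iff hy hy0 w y v
    rw [sub_self] at hev
    have hρ : R (v - y) (BondConfig.relabel (sym2Equiv (Site.shift (-y))) ω) =
        (fun y' : Site d => y' - y) '' R v ω := by
      simp only [hR]
      exact openRootSet_shift hy hy0 w v
    have hρ' : (R (v - y) (BondConfig.relabel (sym2Equiv (Site.shift (-y))) ω)).encard =
        (R v ω).encard := by
      rw [hρ, (sub_left_injective (b := y)).encard_image]
    have hB := halfSpaceFootprint_shift hy hy0
    by_cases hE : 1 ≤ v 0 ∧ v ∈ halfSpaceCluster ω ∧ s(y, y + Pi.single 0 1) ∈ ω ∧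
        ω ∈ openConnIn {x : Site d | 1 ≤ x 0} (y + Pi.single 0 1) (v + w) ∧
        ω ∉ openConnIn {x : Site d | 1 ≤ x 0} (y + Pi.single 0 1) v
    · rw [Set.indicator_of_mem (show ω ∈ {ω' : BondConfig (Site d) | y ∈ halfSpaceCluster ω' ∧
          y 0 = 0 ∧ (1 ≤ v 0 ∧ v ∈ halfSpaceCluster ω' ∧ s(y, y + Pi.single 0 1) ∈ ω' ∧
            ω' ∈ openConnIn {x : Site d | 1 ≤ x 0} (y + Pi.single 0 1) (v + w) ∧
            ω' ∉ openConnIn {x : Site d | 1 ≤ x 0} (y + Pi.single 0 1) v)} from ⟨hy, hy0, hE⟩),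
        Set.indicator_of_mem (show BondConfig.relabel (sym2Equiv (Site.shift (-y))) ω ∈
          {ω' : BondConfig (Site d) | -y ∈ halfSpaceCluster ω' ∧ y 0 = 0 ∧ (1 ≤ (v - y) 0 ∧
            v - y ∈ halfSpaceCluster ω' ∧ s((0 : Site d), (0 : Site d) + Pi.single 0 1) ∈ ω' ∧
            ω' ∈ openConnIn {x : Site d | 1 ≤ x 0} ((0 : Site d) + Pi.single 0 1) (v - y + w) ∧
            ω' ∉ openConnIn {x : Site d | 1 ≤ x 0} ((0 : Site d) + Pi.single 0 1) (v - y))} from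
          ⟨neg_mem_halfSpaceCluster_shift hy hy0, hy0, hev.2 hE⟩)]
      simp only [hρ', hB]
    · rw [Set.indicator_of_notMem (show ω ∉ {ω' : BondConfig (Site d) | y ∈ halfSpaceCluster ω' ∧
          y 0 = 0 ∧ (1 ≤ v 0 ∧ v ∈ halfSpaceCluster ω' ∧ s(y, y + Pi.single 0 1) ∈ ω' ∧
            ω' ∈ openConnIn {x : Site d | 1 ≤ x 0} (y + Pi.single 0 1) (v + w) ∧
            ω' ∉ openConnIn {x : Site d | 1 ≤ x 0} (y + Pi.single 0 1) v)} from fun h => hE h.2.2),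
        Set.indicator_of_notMem (show BondConfig.relabel (sym2Equiv (Site.shift (-y))) ω ∉
          {ω' : BondConfig (Site d) | -y ∈ halfSpaceCluster ω' ∧ y 0 = 0 ∧ (1 ≤ (v - y) 0 ∧
            v - y ∈ halfSpaceCluster ω' ∧ s((0 : Site d), (0 : Site d) + Pi.single 0 1) ∈ ω' ∧
            ω' ∈ openConnIn {x : Site d | 1 ≤ x 0} ((0 : Site d) + Pi.single 0 1) (v - y + w) ∧
            ω' ∉ openConnIn {x : Site d | 1 ≤ x 0} ((0 : Site d) + Pi.single 0 1) (v - y))} from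
          fun h => hE (hev.1 h.2.2))]
  -- step 3 (a.e.): the re-rooted double sum is `|U ∩ ∂ℍ| · (Σ_{u ∈ M ω} 1/ρ(u)) / |U ∩ ∂ℍ|`
  have hstep3 : ∀ᵐ ω ∂(bondPercolation (zdGraph d) p), ∑' y, ∑' u, G y u ω =
      ∑' u, (M ω).indicator (fun u => ((((R u ω).encard : ℕ∞) : ℝ≥0∞))⁻¹) u := by
    filter_upwards [hae] with ω hω
    set S : ℝ≥0∞ := ∑' u, (M ω).indicator (fun u => ((((R u ω).encard : ℕ∞) : ℝ≥0∞))⁻¹) u with hS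
    have hinner : ∀ y, ∑' u, G y u ω = {y' : Site d | -y' ∈ halfSpaceCluster ω ∧ y' 0 = 0}.indicator
        (fun _ => S * (((halfSpaceFootprint ω : ℕ∞) : ℝ≥0∞))⁻¹) y := by
      intro y
      simp only [hG]
      by_cases hy : -y ∈ halfSpaceCluster ω ∧ y 0 = 0
      · rw [Set.indicator_of_mem (show y ∈ {y' : Site d | -y' ∈ halfSpaceCluster ω ∧ y' 0 = 0}
          from hy), hS, ← ENNReal.tsum_mul_right]
        refine tsum_congr fun u => ?_
        by_cases hu : u ∈ M ω
        · rw [Set.indicator_of_mem hu, Set.indicator_of_mem (show ω ∈ {ω' : BondConfig (Site d) |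
              -y ∈ halfSpaceCluster ω' ∧ y 0 = 0 ∧ (1 ≤ u 0 ∧ u ∈ halfSpaceCluster ω' ∧
                s((0 : Site d), (0 : Site d) + Pi.single 0 1) ∈ ω' ∧
                ω' ∈ openConnIn {x : Site d | 1 ≤ x 0} ((0 : Site d) + Pi.single 0 1) (u + w) ∧
                ω' ∉ openConnIn {x : Site d | 1 ≤ x 0} ((0 : Site d) + Pi.single 0 1) u)} from
            ⟨hy.1, hy.2, hu⟩)]
        · rw [Set.indicator_of_notMem hu, zero_mul]
          exact Set.indicator_of_notMem (show ω ∉ {ω' : BondConfig (Site d) | _} from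
            fun h => hu h.2.2) _
      · rw [Set.indicator_of_notMem (show y ∉ {y' : Site d | -y' ∈ halfSpaceCluster ω ∧ y' 0 = 0}
          from hy)]
        refine ENNReal.tsum_eq_zero.2 fun u => ?_
        exact Set.indicator_of_notMem (show ω ∉ {ω' : BondConfig (Site d) | _} from
          fun h => hy ⟨h.1, h.2.1⟩) _
    have hB0 : (((halfSpaceFootprint ω : ℕ∞) : ℝ≥0∞)) ≠ 0 := by
      rw [Ne, ENat.toENNReal_eq_zero]
      exact fun h => by simpa [h] using one_le_halfSpaceFootprint ω
    have hBtop : (((halfSpaceFootprint ω : ℕ∞) : ℝ≥0∞)) ≠ ⊤ := by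
      rw [Ne, ENat.toENNReal_eq_top, halfSpaceFootprint_def]
      exact ((hω.2.subset Set.inter_subset_left).encard_lt_top).ne
    rw [tsum_congr hinner, ← tsum_subtype, ENNReal.tsum_set_const, encard_neg_floor_eq_footprint,
      mul_comm, mul_assoc, ENNReal.inv_mul_cancel hB0 hBtop, mul_one]
  -- assembling: Tonelli, shift invariance, re-indexing `v ↦ v - y`, Tonelli
  calc ∫⁻ ω, (((halfSpacePinnedPairs ω w ∩ {v | 1 ≤ v 0}).encard : ℕ∞) : ℝ≥0∞) /
        ((halfSpaceFootprint ω : ℕ∞) : ℝ≥0∞) ∂(bondPercolation (zdGraph d) p)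
      = ∫⁻ ω, ∑' y, ∑' v, F y v ω ∂(bondPercolation (zdGraph d) p) := lintegral_congr_ae hstep1
    _ = ∑' y, ∫⁻ ω, ∑' v, F y v ω ∂(bondPercolation (zdGraph d) p) :=
        lintegral_tsum fun y => (Measurable.tsum (hFmeas y)).aemeasurable
    _ = ∑' y, ∑' v, ∫⁻ ω, F y v ω ∂(bondPercolation (zdGraph d) p) :=
        tsum_congr fun y => lintegral_tsum fun v => (hFmeas y v).aemeasurable
    _ = ∑' y, ∑' v, ∫⁻ ω, G y (v - y) (BondConfig.relabel (sym2Equiv (Site.shift (-y))) ω)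
          ∂(bondPercolation (zdGraph d) p) :=
        tsum_congr fun y => tsum_congr fun v => lintegral_congr fun ω => hFG y v ω
    _ = ∑' y, ∑' v, ∫⁻ ω, G y (v - y) ω ∂(bondPercolation (zdGraph d) p) :=
        tsum_congr fun y => tsum_congr fun v => lintegral_shift (-y) p (G y (v - y))
    _ = ∑' y, ∑' u, ∫⁻ ω, G y u ω ∂(bondPercolation (zdGraph d) p) :=
        tsum_congr fun y => (Equiv.subRight y).tsum_eq
          (fun u => ∫⁻ ω, G y u ω ∂(bondPercolation (zdGraph d) p))
    _ = ∑' y, ∫⁻ ω, ∑' u, G y u ω ∂(bondPercolation (zdGraph d) p) :=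
        tsum_congr fun y => (lintegral_tsum fun u => (hGmeas y u).aemeasurable).symm
    _ = ∫⁻ ω, ∑' y, ∑' u, G y u ω ∂(bondPercolation (zdGraph d) p) :=
        (lintegral_tsum fun y => (Measurable.tsum (hGmeas y)).aemeasurable).symm
    _ = _ := lintegral_congr_ae hstep3

end LowPoint

/-! ## `Assembly2` reduced to the rooted bookkeeping -/

/-- **The cross-bush part of the pinned-pair expectation, rooted at the origin (exact formula at
`p_c(ℤ³)`).** With `ℍ = {x₀ ≥ 0}`, `U` the critical half-space cluster of `0`, `e₀ = Pi.single 0 1`,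
`M⁰_L = {u : u₀ ≥ 1, u ∈ U, {0, e₀} open, e₀ ↔ u + L e₀, e₀ ↮ u in {x₀ ≥ 1}}` and
`κ = |{y ∈ U ∩ ∂ℍ : {y, y + e₀} open, y + e₀ ↔ e₀ in {x₀ ≥ 1}}|`:
`E_{p_c}[N^{cross}_{L e₀}(U)/|U ∩ ∂ℍ|] = E_{p_c}[|M⁰_L|/κ]` for every `L`
(`U` is a.s. finite at `p_c`, Barsky–Grimmett–Newman). [folklore] -/
theorem lintegral_crossPinned_eq_rooted (L : ℕ) :
    ∫⁻ ω, (((halfSpacePinnedPairs ω (Pi.single 0 (L : ℤ)) ∩ {v : Site 3 | 1 ≤ v 0}).encard : ℕ∞) :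
        ℝ≥0∞) / ((halfSpaceFootprint ω : ℕ∞) : ℝ≥0∞) ∂(bondPercolation (zdGraph 3) (criticalProbI 3)) =
      ∫⁻ ω, (({u : Site 3 | 1 ≤ u 0 ∧ u ∈ halfSpaceCluster ω ∧
            s((0 : Site 3), (0 : Site 3) + Pi.single 0 1) ∈ ω ∧
            ω ∈ openConnIn {x : Site 3 | 1 ≤ x 0} ((0 : Site 3) + Pi.single 0 1)
              (u + Pi.single 0 (L : ℤ)) ∧
            ω ∉ openConnIn {x : Site 3 | 1 ≤ x 0} ((0 : Site 3) + Pi.single 0 1) u}.encard : ℕ∞) :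
              ℝ≥0∞) /
          (({y : Site 3 | y ∈ halfSpaceCluster ω ∧ y 0 = 0 ∧ s(y, y + Pi.single 0 1) ∈ ω ∧
            ω ∈ openConnIn {x : Site 3 | 1 ≤ x 0} (y + Pi.single 0 1)
              ((0 : Site 3) + Pi.single 0 1)}.encard : ℕ∞) : ℝ≥0∞)
        ∂(bondPercolation (zdGraph 3) (criticalProbI 3)) := by
  rw [LowPoint.lintegral_crossPinned_div_footprint_eq (criticalProbI 3) (by simp)
    (LowPoint.ae_finite_halfSpaceCluster (criticalProbI 3) le_rfl)]
  exact lintegral_congr fun ω => LowPoint.tsum_indicator_openRootCount_inv_eq ω _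

/-- **`θ(p_c(ℤ³)) = 0` from the decay of the rooted cross-bush pairs**: if `E_{p_c}[|M⁰_L|/κ] → 0`
as `L → ∞` (notation of `lintegral_crossPinned_eq_rooted`), then `θ(p_c) = 0` on `ℤ³`
(`percolationContinuityZ3_of_tendsto_crossPinned`). [folklore] -/
theorem percolationContinuityZ3_of_tendsto_rootedCross
    (h : Tendsto (fun L : ℕ => ∫⁻ ω, (({u : Site 3 | 1 ≤ u 0 ∧ u ∈ halfSpaceCluster ω ∧
            s((0 : Site 3), (0 : Site 3) + Pi.single 0 1) ∈ ω ∧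
            ω ∈ openConnIn {x : Site 3 | 1 ≤ x 0} ((0 : Site 3) + Pi.single 0 1)
              (u + Pi.single 0 (L : ℤ)) ∧
            ω ∉ openConnIn {x : Site 3 | 1 ≤ x 0} ((0 : Site 3) + Pi.single 0 1) u}.encard : ℕ∞) :
              ℝ≥0∞) /
          (({y : Site 3 | y ∈ halfSpaceCluster ω ∧ y 0 = 0 ∧ s(y, y + Pi.single 0 1) ∈ ω ∧
            ω ∈ openConnIn {x : Site 3 | 1 ≤ x 0} (y + Pi.single 0 1)
              ((0 : Site 3) + Pi.single 0 1)}.encard : ℕ∞) : ℝ≥0∞)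
        ∂(bondPercolation (zdGraph 3) (criticalProbI 3))) atTop (𝓝 0)) :
    _root_.PercolationContinuityZ3 :=
  percolationContinuityZ3_of_tendsto_crossPinned
    (h.congr fun L => (lintegral_crossPinned_eq_rooted L).symm)

open Summit.CriticalPhenomena.PercolationContinuityZ3.Theses.PercLowPointHalfSpace in
/-- **`Assembly2` reduced to its bookkeeping step (rooted form).** The route item `Assembly2`
(`FloorSubcritical → A → B → C → PercolationContinuityZ3`) follows from the single implication
`FloorSubcritical → A → B → C → (E_{p_c}[|M⁰_L|/κ] → 0)` — the route's cross-bush bookkeeping, the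
only step of its proof plan that is not in the tree. [folklore] -/
theorem assembly2_of_rootedCross_bookkeeping
    (hbook : FloorSubcritical → BoundaryTwoArmDecay → TallClusterMassBound → QuantitativeBGN →
      Tendsto (fun L : ℕ => ∫⁻ ω, (({u : Site 3 | 1 ≤ u 0 ∧ u ∈ halfSpaceCluster ω ∧
            s((0 : Site 3), (0 : Site 3) + Pi.single 0 1) ∈ ω ∧
            ω ∈ openConnIn {x : Site 3 | 1 ≤ x 0} ((0 : Site 3) + Pi.single 0 1)
              (u + Pi.single 0 (L : ℤ)) ∧
            ω ∉ openConnIn {x : Site 3 | 1 ≤ x 0} ((0 : Site 3) + Pi.single 0 1) u}.encard : ℕ∞) :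
              ℝ≥0∞) /
          (({y : Site 3 | y ∈ halfSpaceCluster ω ∧ y 0 = 0 ∧ s(y, y + Pi.single 0 1) ∈ ω ∧
            ω ∈ openConnIn {x : Site 3 | 1 ≤ x 0} (y + Pi.single 0 1)
              ((0 : Site 3) + Pi.single 0 1)}.encard : ℕ∞) : ℝ≥0∞)
        ∂(bondPercolation (zdGraph 3) (criticalProbI 3))) atTop (𝓝 0)) :
    Assembly2 :=
  fun hF hA hB hC => percolationContinuityZ3_of_tendsto_rootedCross (hbook hF hA hB hC)

end Summit.CriticalPhenomena.PercolationContinuityZ3.Theorems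

end
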